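import Literature.NumberTheory.Sieve.HeathBrownMorozResidueClassesSieve
import Literature.NumberTheory.Sieve.CubicFormLocalCount
import Literature.NumberTheory.Sieve.HeathBrownCubicPrimesProofs
import Literature.NumberTheory.Sieve.DivisorPowerSums
import Mathlib.Data.Int.CardIntervalMod
import Mathlib.Data.Rat.Floor
import HarnessLib

/-!
# A Brun–Titchmarsh bound for the values of `x³ + 2y³` with `(x, y)` in a residue class, PROVED

Topic `Literature/NumberTheory/Sieve`, namespace `Literature.NumberTheory.Sieve.CubicPrimes`; companion of
`HeathBrownMorozResidueClassesSieve.lean` (the VALUE sieve of the coset sequence of Heath-Brown–Moroz,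
density `Γ(q) = ν_q/∏(p+1)`, whose remainder needs the coset Type-I bound of [HeathBrownMoroz2004,
Lemma 2.3]) and of `CubicFormLocalCount.lean` (the local count `#{(x,y) mod p : x³ + 2y³ ≡ 0} =
1 + (p−1)ν_p`, [IrelandRosen1990, Ch. 8]).  Here the same upper-bound sieve is run with the PAIR density
— the classes of pairs `(x, y) (mod q)` with `q ∣ x³ + 2y³` — whose Type-I input is the TRIVIAL count of
lattice points of an arithmetic progression in an interval (`|#{A < x ≤ A+L : x ≡ c (mod m)} − L/m| ≤ 1`);
this loses nothing in the main term (the pair density `ω_p/p² = (1 + (p−1)ν_p)/p²` exceeds the value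
density `ν_p/(p+1)` termwise, so the sieve product is SMALLER) and gives a bound UNIFORM in the modulus
of the class, at the classical Brun–Titchmarsh strength:

* **`card_classBoxPairs_prime_le`** — there are absolute `C, L₀` such that for every box
  `(A, A+L] × (A', A'+L]`, every modulus `d ≥ 1` and every ADMISSIBLE class `(a, b) (mod d)`
  (`gcd(a³ + 2b³, d) = 1`) with `L/d ≥ L₀`,

    `#{(x, y) : A < x ≤ A+L, A' < y ≤ A'+L, x ≡ a, y ≡ b (mod d), x³ + 2y³ prime}`
      `≤ C · 𝔈(d) · (L/d)² / log(L/d)`,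

  `𝔈(d) = ∏_{p∣d} (p+1)/(p+1−ν_p)` the density enhancement of an admissible class
  (`coprimeClassWeight`, `HeathBrownMorozResidueClassesSieve`), i.e. the expected order
  `#class box / log(side)` up to the constant — the analogue for the norm form `x³ + 2y³` of the
  Brun–Titchmarsh inequality `π(x; q, a) ≪ x/(φ(q) log(x/q))` [HalberstamRichert1974, Thm 3.7], proved
  the same way: an upper-bound sieve of small level with trivial remainders
  [HalberstamRichert1974, Thm 2.2 / Thm 2.5 with (1.4.14)], here the tree's PROVED Fundamental Lemma
  `SieveSequence.fundamental_lemma_uniform_holds` (dimension `3`, constant `dimConst`, uniform in the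
  sequence) at `z = D = (L/d)^{1/2}`, together with Heath-Brown's Mertens-type bound
  `∏_{p<z}(1 − ν_p/(p+1)) ≤ C/log z` (`CubicSieve.exists_prodA_le`, from the PROVED convergence of the
  singular product `HeathBrown2001_singularProduct_holds`, [HeathBrownActa2001, §6 (6.7)]).
* `card_classBoxPairs_rough_le` — the same bound for the pairs whose value has no prime factor
  `< (L/d)^{1/2}` (the sifted quantity itself).
* The sieve set-up, all PROVED: `pairZeroCount q = ω(q) = #{(u, v) mod q : q ∣ u³ + 2v³}` with
  `pairZeroCount_prime` (`ω(p) = 1 + (p−1)ν_p`, from `cubicPairCount_zero`), `pairZeroCount_mul`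
  (multiplicativity, Chinese remainder theorem) and `pairZeroCount_le` (`ω(p) ≤ 3p − 2`);
  `pairClassDensity d` (`g_d(p) = ω(p)/p²` for `p ∤ d`, `0` for `p ∣ d`) with
  `hasSieveDimension_pairClassDensity : HasSieveDimension (pairClassDensity d) 3 dimConst` (uniform in
  `d`); the class box `classBoxPairs A A' L d a b` and the sifted sequence `seqPairBox` (weights = number
  of class-box pairs with a given value, size `(L/d)²`); the progression count
  `abs_card_Ioc_filter_modEq_sub_le`; the Type-I estimate `abs_congrSum_seqPairBox_sub_le`
  (`|#𝒜_q − ω(q)(L/(dq))²| ≤ ω(q)(2L/(dq) + 1)` for square-free `q` coprime to `d`, and `#𝒜_q = 0` when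
  `(q, d) > 1`), the remainder bound `abs_remainder_seqPairBox_le` (`|R_q| ≤ τ(q)²(2L/d + q)`), and the
  main-term comparison `densityProduct_seqPairBox_le` (`V(z) ≤ 𝔈(d) · ∏_{p<z}(1 − ν_p/(p+1))`).

This is the «ClassBrunTitchmarshHB» input (Brun–Titchmarsh for Heath-Brown primes in residue classes to
moduli `d ≤ (ηX)^{1−δ}`, by «the β-sieve upper bound with axis-lattice counts, no coset Type-I») of the
dispersion route for `p + (x³ + 2y³)` in the parity-ideate cell; summing the bound over the `ν_d(r)`
admissible classes `(a, b)` with `a³ + 2b³ ≡ r (mod d)` bounds the Heath-Brown primes `≡ r (mod d)`.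

## References

* [HalberstamRichert1974] H. Halberstam, H.-E. Richert, *Sieve Methods*, Academic Press 1974: Thm 2.2
  (upper-bound sieve with trivial remainders), Thm 2.5 (Fundamental Lemma), (1.4.14), Thm 3.7
  (Brun–Titchmarsh).
* [HeathBrownActa2001] D. R. Heath-Brown, *Primes represented by `x³ + 2y³`*, Acta Math. 186 (2001)
  1–84: §6 p. 34–35 and (6.7) (the upper-bound sieve for `𝒜` with density `ρ₀(p)/p`, Mertens' estimate
  for `∏(1 − ν_p/(p+1))`).
* [HeathBrownMoroz2004] D. R. Heath-Brown, B. Z. Moroz, *On the representation of primes by cubic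
  polynomials in two variables*, Proc. LMS (3) 88 (2004): §2 (2.3)–(2.4) (splitting `#𝒜_q` over the
  residue classes `u⃗ (mod q)` with `q ∣ f(u⃗)`), Lemma 2.4 (iv) and (2.35)–(2.36) (the local counts),
  §3 (3.1) (the class enhancement).
* [IrelandRosen1990] K. Ireland, M. Rosen, *A Classical Introduction to Modern Number Theory*, 2nd ed.,
  GTM 84, Ch. 8 §7 (the count of `x³ + 2y³ ≡ 0 (mod p)`).

## Mathlib / tree search

Tree: `CubicPrimes.cubicPairCount(_zero/_def)` (`CubicFormLocalCount`), `cubeRootTwoCount(_two/_three/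
_five/_le_three)`, `cast_add_one_sub_cubeRootTwoCount_pos`, `coprimeClassWeight`, `classEnhancementBelow(_le)`,
`one_sub_densA_pos_le` (`HeathBrownMorozResidueClasses(Sieve)`), `CubicSieve.densA(_prime)`, `dimConst`,
`hasSieveDimension_of_le_div`, `prodA(_pos_le)`, `exists_prodA_le`, `HeathBrown2001_singularProduct_holds`,
`SieveSequence` / `HasSieveDimension` / `primesProdBelow` / `fundamental_lemma_uniform_holds`
(`SieveFramework`, `SieveFrameworkFundamentalLemma`), `exists_sum_sigma_zero_pow_le_real` (`DivisorPowerSums`).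
Mathlib: `Nat.Ioc_filter_modEq_card`, `Rat.floor_intCast_div_natCast`, `Nat.chineseRemainder`,
`Nat.modEq_and_modEq_iff_modEq_mul`, `ZMod.chineseRemainder`, `Finset.filter_product`,
`Finset.card_eq_sum_card_fiberwise`, `ArithmeticFunction.isMultiplicative_sigma`,
`Asymptotics.isLittleO_log_rpow_rpow_atTop`. `lean search 'pairZeroCount|classBoxPairs|seqPairBox'`:
nothing before this file.
-/

noncomputable section

open Finset Filter Topology
open scoped ArithmeticFunction.sigma

namespace Literature.NumberTheory.Sieve.CubicPrimes

open CubicSieve (densA densA_prime dimConst hasSieveDimension_of_le_div prodA prodA_pos_le)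

/-! ### The local pair count `ω(q) = #{(u, v) mod q : q ∣ u³ + 2v³}` -/

/-- `ω(q)`: the number of pairs of residues `(u, v) (mod q)` with `q ∣ u³ + 2v³` — the number of classes
of pairs removed by the sieve at a square-free `q` (Heath-Brown–Moroz's `m(q)` of (2.3) for `γ⃗ = 0`,
`d = 1`; junk value `0` at `q = 0`). [cite: HeathBrownMoroz2004, §2 (2.3)] -/
def pairZeroCount (q : ℕ) : ℕ := #{uv ∈ range q ×ˢ range q | q ∣ uv.1 ^ 3 + 2 * uv.2 ^ 3}

/-- `ω(q)` counted in `(ℤ/qℤ)²`. [cite: HeathBrownMoroz2004, §2 (2.3)] -/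
theorem pairZeroCount_eq_card_zmod (q : ℕ) [NeZero q] :
    pairZeroCount q = #{v : ZMod q × ZMod q | v.1 ^ 3 + 2 * v.2 ^ 3 = 0} := by
  classical
  rw [pairZeroCount]
  refine Finset.card_nbij' (fun uv => ((uv.1 : ZMod q), (uv.2 : ZMod q)))
    (fun v => (v.1.val, v.2.val)) ?_ ?_ ?_ ?_
  · intro uv huv
    rw [mem_coe, mem_filter, mem_product, mem_range, mem_range] at huv
    simp only [mem_coe, mem_filter, mem_univ, true_and]
    have h := (ZMod.natCast_eq_zero_iff (uv.1 ^ 3 + 2 * uv.2 ^ 3) q).mpr huv.2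
    push_cast at h
    exact h
  · intro v hv
    simp only [mem_coe, mem_filter, mem_univ, true_and] at hv
    rw [mem_coe, mem_filter, mem_product, mem_range, mem_range]
    refine ⟨⟨ZMod.val_lt v.1, ZMod.val_lt v.2⟩, ?_⟩
    rw [← ZMod.natCast_eq_zero_iff]
    push_cast
    rw [ZMod.natCast_zmod_val, ZMod.natCast_zmod_val]
    exact hv
  · intro uv huv
    rw [mem_coe, mem_filter, mem_product, mem_range, mem_range] at huv
    simp only [ZMod.val_natCast_of_lt huv.1.1, ZMod.val_natCast_of_lt huv.1.2]
  · intro v _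
    simp only [ZMod.natCast_zmod_val]

/-- **`ω(p) = 1 + (p − 1)ν_p` at a prime** (`ν_p` = number of cube roots of `2 (mod p)`): the pair
`(0,0)` and, for each of the `p − 1` residues `v ≠ 0`, the `ν_p` residues `u` with `(u/v)³ = −2`
(the tree's `cubicPairCount_zero`, Ireland–Rosen Ch. 8). [cite: HeathBrownMoroz2004, Lemma 2.4 (iv) and (2.35)] -/
theorem pairZeroCount_prime {p : ℕ} (hp : p.Prime) :
    pairZeroCount p = 1 + (p - 1) * cubeRootTwoCount p := by
  haveI := Fact.mk hp
  rw [pairZeroCount_eq_card_zmod, ← cubicPairCount_def, cubicPairCount_zero]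

/-- `ω(p) = 1 + (p − 1)ν_p` in `ℝ`. [cite: HeathBrownMoroz2004, Lemma 2.4 (iv) and (2.35)] -/
theorem pairZeroCount_prime_real {p : ℕ} (hp : p.Prime) :
    (pairZeroCount p : ℝ) = 1 + ((p : ℝ) - 1) * cubeRootTwoCount p := by
  rw [pairZeroCount_prime hp, Nat.cast_add, Nat.cast_mul, Nat.cast_sub hp.one_le]
  simp

/-- `ω(p) ≤ 3p − 2 < 3p` (`ν_p ≤ 3`). [cite: HeathBrownMoroz2004, Lemma 2.4 (i)] -/
theorem pairZeroCount_le {p : ℕ} (hp : p.Prime) : (pairZeroCount p : ℝ) ≤ 3 * p - 2 := by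
  rw [pairZeroCount_prime_real hp]
  have hν : (cubeRootTwoCount p : ℝ) ≤ 3 := by exact_mod_cast cubeRootTwoCount_le_three hp
  have hp1 : (1 : ℝ) ≤ p := by exact_mod_cast hp.one_le
  nlinarith

/-- `ω(1) = 1`. [cite: HeathBrownMoroz2004, §2 (2.3)] -/
theorem pairZeroCount_one : pairZeroCount 1 = 1 := by
  decide

/-- **`ω` is multiplicative** (Chinese remainder theorem in both coordinates).
[cite: HeathBrownMoroz2004, §2 (2.3) and Lemma 2.4 (multiplicativity of the local counts)] -/
theorem pairZeroCount_mul {m n : ℕ} (hm : m ≠ 0) (hn : n ≠ 0) (h : m.Coprime n) :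
    pairZeroCount (m * n) = pairZeroCount m * pairZeroCount n := by
  classical
  haveI : NeZero m := ⟨hm⟩
  haveI : NeZero n := ⟨hn⟩
  haveI : NeZero (m * n) := ⟨mul_ne_zero hm hn⟩
  rw [pairZeroCount_eq_card_zmod, pairZeroCount_eq_card_zmod, pairZeroCount_eq_card_zmod,
    ← card_product]
  set ψ := ZMod.chineseRemainder h with hψ
  refine card_nbij' (fun v => (((ψ v.1).1, (ψ v.2).1), ((ψ v.1).2, (ψ v.2).2)))
    (fun w => (ψ.symm (w.1.1, w.2.1), ψ.symm (w.1.2, w.2.2))) ?_ ?_ ?_ ?_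
  · intro v hv
    simp only [mem_coe, mem_filter, mem_univ, true_and] at hv
    simp only [mem_coe, mem_product, mem_filter, mem_univ, true_and]
    have key : ψ (v.1 ^ 3 + 2 * v.2 ^ 3) = 0 := by rw [hv, map_zero]
    rw [map_add, map_mul, map_pow, map_pow, map_ofNat] at key
    have k1 := congr_arg Prod.fst key
    have k2 := congr_arg Prod.snd key
    simp only [Prod.fst_add, Prod.fst_mul, Prod.pow_fst, Prod.fst_ofNat, Prod.fst_zero,
      Prod.snd_add, Prod.snd_mul, Prod.pow_snd, Prod.snd_ofNat, Prod.snd_zero] at k1 k2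
    exact ⟨k1, k2⟩
  · intro w hw
    simp only [mem_coe, mem_product, mem_filter, mem_univ, true_and] at hw
    simp only [mem_coe, mem_filter, mem_univ, true_and]
    apply ψ.injective
    rw [map_add, map_mul, map_pow, map_pow, map_ofNat, map_zero, RingEquiv.apply_symm_apply,
      RingEquiv.apply_symm_apply]
    ext
    · simp only [Prod.fst_add, Prod.fst_mul, Prod.pow_fst, Prod.fst_ofNat, Prod.fst_zero]; exact hw.1
    · simp only [Prod.snd_add, Prod.snd_mul, Prod.pow_snd, Prod.snd_ofNat, Prod.snd_zero]; exact hw.2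
  · intro v _
    simp only [Prod.mk.eta, RingEquiv.symm_apply_apply]
  · intro w _
    simp only [RingEquiv.apply_symm_apply, Prod.mk.eta]

/-- `ω` of a product of distinct primes is the product of the `ω(p)`. [cite: HeathBrownMoroz2004, Lemma 2.4] -/
theorem pairZeroCount_prod_primes {s : Finset ℕ} (hs : ∀ p ∈ s, p.Prime) :
    pairZeroCount (∏ p ∈ s, p) = ∏ p ∈ s, pairZeroCount p := by
  classical
  induction s using Finset.induction_on with
  | empty => simp [pairZeroCount_one]
  | insert a s ha ih =>
    have hsa : ∀ p ∈ s, p.Prime := fun p hp => hs p (mem_insert_of_mem hp)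
    have hap : a.Prime := hs a (mem_insert_self a s)
    rw [prod_insert ha, prod_insert ha]
    have hcop : a.Coprime (∏ p ∈ s, p) :=
      Nat.Coprime.prod_right fun p hp => (Nat.coprime_primes hap (hsa p hp)).mpr
        (fun h => ha (h ▸ hp))
    have hne : (∏ p ∈ s, p) ≠ 0 := prod_ne_zero_iff.mpr fun p hp => (hsa p hp).ne_zero
    rw [pairZeroCount_mul hap.ne_zero hne hcop, ih hsa]

/-- `ω(q) = ∏_{p∣q} ω(p)` for square-free `q`. [cite: HeathBrownMoroz2004, Lemma 2.4] -/
theorem pairZeroCount_of_squarefree {q : ℕ} (hq : Squarefree q) :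
    pairZeroCount q = ∏ p ∈ q.primeFactors, pairZeroCount p := by
  conv_lhs => rw [← Nat.prod_primeFactors_of_squarefree hq]
  exact pairZeroCount_prod_primes fun p hp => Nat.prime_of_mem_primeFactors hp

/-- `ω(q) ≤ 3^{ω(q)}·q ≤ τ(q)²·q` for square-free `q` (`ω(p) ≤ 3p`, `3^{#primes} ≤ 4^{#primes} = τ(q)²`).
[cite: HeathBrownMoroz2004, Lemma 2.4 (i)] -/
theorem pairZeroCount_le_card_divisors_sq_mul {q : ℕ} (hq : Squarefree q) :
    (pairZeroCount q : ℝ) ≤ (#q.divisors : ℝ) ^ 2 * q := by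
  have hq0 : q ≠ 0 := hq.ne_zero
  rw [pairZeroCount_of_squarefree hq, Nat.cast_prod]
  -- `τ(q) = 2^{#primeFactors}` for square-free `q`, via `σ₀`
  have hτ : (#q.divisors : ℝ) = ∏ p ∈ q.primeFactors, (2 : ℝ) := by
    have h := (ArithmeticFunction.isMultiplicative_sigma (k := 0)).multiplicative_factorization
      (ArithmeticFunction.sigma 0) hq0
    rw [ArithmeticFunction.sigma_zero_apply] at h
    rw [h, Finsupp.prod, Nat.support_factorization, Nat.cast_prod]
    refine prod_congr rfl fun p hp => ?_
    have hpp : p.Prime := Nat.prime_of_mem_primeFactors hp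
    have h1 : q.factorization p = 1 := by
      have hle := hq.natFactorization_le_one p
      have hpos : 0 < q.factorization p := hpp.factorization_pos_of_dvd hq0 (Nat.dvd_of_mem_primeFactors hp)
      omega
    rw [h1, pow_one, ArithmeticFunction.sigma_zero_apply, hpp.divisors]
    have : #({1, p} : Finset ℕ) = 2 := card_pair hpp.one_lt.ne
    rw [this]; norm_num
  rw [hτ, ← prod_pow, ← Nat.prod_primeFactors_of_squarefree hq, Nat.cast_prod,
    Nat.prod_primeFactors_of_squarefree hq, ← prod_mul_distrib]
  refine prod_le_prod (fun p _ => Nat.cast_nonneg _) fun p hp => ?_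
  have hpp : p.Prime := Nat.prime_of_mem_primeFactors hp
  have h2 : (2 : ℝ) ≤ p := by exact_mod_cast hpp.two_le
  calc (pairZeroCount p : ℝ) ≤ 3 * p - 2 := pairZeroCount_le hpp
    _ ≤ 2 ^ 2 * p := by nlinarith

/-! ### The pair density `g_d` of an admissible class and its sieve dimension -/

/-- The multiplicative density of the pair sieve for a class modulo `d`: `g_d(p) = ω(p)/p²` for `p ∤ d`
(the proportion of pairs `(x, y) (mod p)` with `p ∣ x³ + 2y³`), and `g_d(p) = 0` for `p ∣ d` (in an
admissible class no value is divisible by `p`), extended multiplicatively over the prime factors.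
[cite: HeathBrownMoroz2004, §2 (2.3)–(2.4) and (2.36)] -/
def pairClassDensity (d : ℕ) : ArithmeticFunction ℝ :=
  ArithmeticFunction.prodPrimeFactors fun p =>
    if p ∣ d then 0 else (pairZeroCount p : ℝ) / (p : ℝ) ^ 2

/-- `g_d` is multiplicative. [cite: HeathBrownMoroz2004, Lemma 2.4] -/
theorem isMultiplicative_pairClassDensity (d : ℕ) : (pairClassDensity d).IsMultiplicative :=
  ArithmeticFunction.IsMultiplicative.prodPrimeFactors _

/-- `g_d(q) = ∏_{p∣q} g_d(p)` for `q ≠ 0`. [cite: HeathBrownMoroz2004, Lemma 2.4] -/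
theorem pairClassDensity_apply (d : ℕ) {q : ℕ} (hq : q ≠ 0) :
    pairClassDensity d q =
      ∏ p ∈ q.primeFactors, (if p ∣ d then 0 else (pairZeroCount p : ℝ) / (p : ℝ) ^ 2) := by
  rw [pairClassDensity, ArithmeticFunction.prodPrimeFactors_apply hq]

/-- `g_d(p)` at a prime. [cite: HeathBrownMoroz2004, Lemma 2.4] -/
theorem pairClassDensity_prime (d : ℕ) {p : ℕ} (hp : p.Prime) :
    pairClassDensity d p = if p ∣ d then 0 else (pairZeroCount p : ℝ) / (p : ℝ) ^ 2 := by
  rw [pairClassDensity_apply d hp.ne_zero, hp.primeFactors, prod_singleton]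

/-- `0 ≤ g_d(p) ≤ 3/p` and `g_d(p) ≤ 1/2` at every prime (`ω(p) ≤ 3p − 2`; `ω(p) = p` for `p = 2, 3, 5`).
[cite: HeathBrownMoroz2004, Lemma 2.4 (i)] -/
theorem pairClassDensity_prime_bounds (d : ℕ) {p : ℕ} (hp : p.Prime) :
    0 ≤ pairClassDensity d p ∧ pairClassDensity d p ≤ 3 / p ∧ pairClassDensity d p ≤ 1 - 1 / 2 := by
  rw [pairClassDensity_prime d hp]
  have hp2 : (2 : ℝ) ≤ p := by exact_mod_cast hp.two_le
  split_ifs with hpd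
  · refine ⟨le_rfl, by positivity, by norm_num⟩
  have hω := pairZeroCount_le hp
  have hω0 : (0 : ℝ) ≤ pairZeroCount p := Nat.cast_nonneg _
  refine ⟨by positivity, ?_, ?_⟩
  · rw [div_le_div_iff₀ (by positivity) (by positivity)]
    nlinarith
  · rw [div_le_iff₀ (by positivity)]
    by_cases h7 : 7 ≤ p
    · have h7' : (7 : ℝ) ≤ p := by exact_mod_cast h7
      nlinarith
    · -- `p ∈ {2, 3, 5}`: `ν_p = 1`, `ω(p) = p`
      have hp' : p = 2 ∨ p = 3 ∨ p = 5 := by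
        have := hp.two_le
        interval_cases p <;> simp_all (config := {decide := true})
      have hωp : (pairZeroCount p : ℝ) = p := by
        rw [pairZeroCount_prime_real hp]
        rcases hp' with rfl | rfl | rfl
        · rw [cubeRootTwoCount_two]; norm_num
        · rw [cubeRootTwoCount_three]; norm_num
        · rw [cubeRootTwoCount_five]; norm_num
      rw [hωp]
      nlinarith

/-- **The pair density satisfies `Ω(3)` uniformly in `d`** (true dimension `1`; the crude `3` only
affects constants): `HasSieveDimension (pairClassDensity d) 3 dimConst`.
[cite: HeathBrownActa2001, §6 p. 34] -/
theorem hasSieveDimension_pairClassDensity (d : ℕ) :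
    HasSieveDimension (pairClassDensity d) 3 dimConst := by
  have h := hasSieveDimension_of_le_div (g := pairClassDensity d) (A := 3) (δ := 1 / 2) (by norm_num)
    (fun p hp => pairClassDensity_prime_bounds d hp)
  simpa [dimConst] using h

/-- **The pair density dominates the value density termwise**: for `p ∤ d`,
`1 − g_d(p) = 1 − (1 + (p−1)ν_p)/p² ≤ 1 − ν_p/(p+1)` (equivalent to `ν_p ≤ p + 1`); for `p ∣ d`,
`1 − g_d(p) = 1`. Hence the pair-sieve product is at most the class-enhanced Heath-Brown product.
[cite: HeathBrownMoroz2004, Lemma 2.4 (iv)] -/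
theorem one_sub_pairClassDensity_le (d : ℕ) {p : ℕ} (hp : p.Prime) :
    1 - pairClassDensity d p ≤ (if p ∣ d then (1 - densA p)⁻¹ else 1) * (1 - densA p) := by
  rw [pairClassDensity_prime d hp]
  have hA := one_sub_densA_pos_le hp
  split_ifs with hpd
  · rw [sub_zero, inv_mul_cancel₀ hA.1.ne']
  · rw [one_mul, densA_prime hp, pairZeroCount_prime_real hp]
    have hp2 : (2 : ℝ) ≤ p := by exact_mod_cast hp.two_le
    have hν : (cubeRootTwoCount p : ℝ) ≤ 3 := by exact_mod_cast cubeRootTwoCount_le_three hp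
    have hν0 : (0 : ℝ) ≤ cubeRootTwoCount p := Nat.cast_nonneg _
    rw [sub_le_sub_iff_left, div_le_div_iff₀ (by positivity) (by positivity)]
    nlinarith

/-! ### Arithmetic progressions in an interval -/

/-- **The trivial lattice count**: for `m ≥ 1`, `|#{A < x ≤ A + L : x ≡ c (mod m)} − L/m| ≤ 1`.
[cite: HalberstamRichert1974, Thm 2.2 (the remainder `|R_d| ≤ 1` of an arithmetic progression)] -/
theorem abs_card_Ioc_filter_modEq_sub_le {m : ℕ} (hm : 0 < m) (A L c : ℕ) :
    |(#{x ∈ Ioc A (A + L) | x ≡ c [MOD m]} : ℝ) - (L : ℝ) / m| ≤ 1 := by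
  have h := Nat.Ioc_filter_modEq_card A (A + L) hm c
  set Fb : ℤ := (((A + L : ℕ) : ℤ) - c) / m with hFb
  set Fa : ℤ := ((A : ℤ) - c) / m with hFa
  have hFb' : ⌊(((A + L : ℕ) : ℚ) - c) / (m : ℚ)⌋ = Fb := by
    rw [show (((A + L : ℕ) : ℚ) - c) = (((((A + L : ℕ) : ℤ) - c : ℤ)) : ℚ) by push_cast; ring,
      Rat.floor_intCast_div_natCast]
  have hFa' : ⌊((A : ℚ) - c) / (m : ℚ)⌋ = Fa := by
    rw [show ((A : ℚ) - c) = ((((A : ℤ) - c : ℤ)) : ℚ) by push_cast; ring,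
      Rat.floor_intCast_div_natCast]
  rw [hFb', hFa'] at h
  have hm' : (0 : ℤ) < m := by exact_mod_cast hm
  have hmono : Fa ≤ Fb := Int.ediv_le_ediv hm' (by push_cast; linarith)
  rw [max_eq_left (sub_nonneg.mpr hmono)] at h
  -- `m Fb ≤ A+L−c < m Fb + m`, `m Fa ≤ A−c < m Fa + m`
  have hb1 := Int.mul_ediv_add_emod (((A + L : ℕ) : ℤ) - c) m
  have hb2 := Int.emod_nonneg (((A + L : ℕ) : ℤ) - c) hm'.ne'
  have hb3 := Int.emod_lt_of_pos (((A + L : ℕ) : ℤ) - c) hm'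
  have ha1 := Int.mul_ediv_add_emod ((A : ℤ) - c) m
  have ha2 := Int.emod_nonneg ((A : ℤ) - c) hm'.ne'
  have ha3 := Int.emod_lt_of_pos ((A : ℤ) - c) hm'
  rw [← hFb] at hb1
  rw [← hFa] at ha1
  push_cast at hb1 hb2 hb3 ha1 ha2 ha3
  have hlo : (L : ℤ) - m < m * (Fb - Fa) := by linarith
  have hhi : m * (Fb - Fa) < (L : ℤ) + m := by linarith
  have hcard : ((#{x ∈ Ioc A (A + L) | x ≡ c [MOD m]} : ℕ) : ℝ) = ((Fb - Fa : ℤ) : ℝ) := by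
    exact_mod_cast h
  have hloR : (L : ℝ) - m < m * ((Fb - Fa : ℤ) : ℝ) := by exact_mod_cast hlo
  have hhiR : (m : ℝ) * ((Fb - Fa : ℤ) : ℝ) < (L : ℝ) + m := by exact_mod_cast hhi
  have hmR : (0 : ℝ) < m := by exact_mod_cast hm
  rw [hcard, abs_le]
  constructor
  · have : (L : ℝ) / m - 1 ≤ ((Fb - Fa : ℤ) : ℝ) := by
      rw [div_sub_one hmR.ne', div_le_iff₀ hmR]; linarith
    linarith
  · have : ((Fb - Fa : ℤ) : ℝ) ≤ (L : ℝ) / m + 1 := by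
      rw [div_add_one hmR.ne', le_div_iff₀ hmR]; linarith
    linarith

/-- Two congruences to coprime moduli are one congruence to the product (Chinese remainder theorem):
`{x : x ≡ a (d), x ≡ r (q)} = {x : x ≡ c (dq)}` for some `c`. [folklore] -/
private theorem exists_filter_modEq_and_eq {d q : ℕ} (hdq : d.Coprime q) (a r : ℕ) (S : Finset ℕ) :
    ∃ c : ℕ, S.filter (fun x => x ≡ a [MOD d] ∧ x ≡ r [MOD q]) = S.filter (fun x => x ≡ c [MOD d * q]) := by
  obtain ⟨c, hca, hcr⟩ := Nat.chineseRemainder hdq a r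
  refine ⟨c, filter_congr fun x _ => ?_⟩
  rw [← Nat.modEq_and_modEq_iff_modEq_mul hdq]
  exact ⟨fun h => ⟨h.1.trans hca.symm, h.2.trans hcr.symm⟩, fun h => ⟨h.1.trans hca, h.2.trans hcr⟩⟩

/-- **Progression count with two coprime moduli**: for `d, q ≥ 1` coprime,
`|#{A < x ≤ A+L : x ≡ a (d), x ≡ r (q)} − L/(dq)| ≤ 1`. [cite: HalberstamRichert1974, Thm 2.2 (the remainder `|R_d| ≤ 1` of an arithmetic progression)] -/
theorem abs_card_Ioc_filter_modEq_and_sub_le {d q : ℕ} (hd : 0 < d) (hq : 0 < q) (hdq : d.Coprime q)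
    (A L a r : ℕ) :
    |(#{x ∈ Ioc A (A + L) | x ≡ a [MOD d] ∧ x ≡ r [MOD q]} : ℝ) - (L : ℝ) / (d * q)| ≤ 1 := by
  obtain ⟨c, hc⟩ := exists_filter_modEq_and_eq hdq a r (Ioc A (A + L))
  rw [hc, show ((d : ℝ) * q) = ((d * q : ℕ) : ℝ) by push_cast; ring]
  exact abs_card_Ioc_filter_modEq_sub_le (Nat.mul_pos hd hq) A L c

/-! ### The class box and its sifted sequence -/

/-- The pairs `(x, y)` with `A < x ≤ A + L`, `A' < y ≤ A' + L` and `x ≡ a`, `y ≡ b (mod d)` — a box of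
side `L` intersected with a residue class of pairs. [cite: HeathBrownMoroz2004, §1 (the class `x⃗ ≡ γ⃗ (mod d)`)] -/
def classBoxPairs (A A' L d a b : ℕ) : Finset (ℕ × ℕ) :=
  (Ioc A (A + L)).filter (fun x => x ≡ a [MOD d]) ×ˢ (Ioc A' (A' + L)).filter (fun y => y ≡ b [MOD d])

/-- Membership in `classBoxPairs`. [cite: HeathBrownMoroz2004, §1 (the class `x⃗ ≡ γ⃗ (mod d)`)] -/
theorem mem_classBoxPairs_iff {A A' L d a b : ℕ} {xy : ℕ × ℕ} :
    xy ∈ classBoxPairs A A' L d a b ↔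
      (A < xy.1 ∧ xy.1 ≤ A + L) ∧ xy.1 ≡ a [MOD d] ∧ (A' < xy.2 ∧ xy.2 ≤ A' + L) ∧ xy.2 ≡ b [MOD d] := by
  simp only [classBoxPairs, mem_product, mem_filter, mem_Ioc, and_assoc]

/-- **The class box has `(L/d + O(1))²` pairs**: `#classBoxPairs ≤ (L/d + 1)²`.
[cite: HalberstamRichert1974, Thm 2.2 (the remainder `|R_d| ≤ 1` of an arithmetic progression)] -/
theorem card_classBoxPairs_le {d : ℕ} (hd : 0 < d) (A A' L a b : ℕ) :
    (#(classBoxPairs A A' L d a b) : ℝ) ≤ ((L : ℝ) / d + 1) ^ 2 := by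
  rw [classBoxPairs, card_product, Nat.cast_mul, sq]
  have h1 := (abs_le.mp (abs_card_Ioc_filter_modEq_sub_le hd A L a)).2
  have h2 := (abs_le.mp (abs_card_Ioc_filter_modEq_sub_le hd A' L b)).2
  have hL : (0 : ℝ) ≤ (L : ℝ) / d := by positivity
  exact mul_le_mul (by linarith) (by linarith) (Nat.cast_nonneg _) (by linarith)

/-- An upper bound for the values on the box: `(A + L)³ + 2(A' + L)³`. [cite: HeathBrownMoroz2004, §1 (1.1)] -/
def classBoxTop (A A' L : ℕ) : ℕ := (A + L) ^ 3 + 2 * (A' + L) ^ 3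

/-- The values of the class box lie in `(0, classBoxTop]`. [cite: HeathBrownMoroz2004, §1 (1.1)] -/
theorem value_mem_Ioc_of_mem_classBoxPairs {A A' L d a b : ℕ} {xy : ℕ × ℕ}
    (h : xy ∈ classBoxPairs A A' L d a b) :
    xy.1 ^ 3 + 2 * xy.2 ^ 3 ∈ Ioc 0 (classBoxTop A A' L) := by
  obtain ⟨⟨hx1, hx2⟩, -, ⟨-, hy2⟩, -⟩ := mem_classBoxPairs_iff.mp h
  rw [mem_Ioc, classBoxTop]
  constructor
  · have : 0 < xy.1 := by omega
    positivity
  · gcongr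

/-- **The class box as a sifted sequence** (the PAIR sieve): weights
`a_k = #{(x, y) ∈ classBoxPairs : x³ + 2y³ = k}`, expected size `(L/d)²`, density `g_d`.
[cite: HeathBrownMoroz2004, §2 (2.3)–(2.4)] -/
def seqPairBox (A A' L d a b : ℕ) : SieveSequence where
  a k := (#{xy ∈ classBoxPairs A A' L d a b | xy.1 ^ 3 + 2 * xy.2 ^ 3 = k} : ℝ)
  a_nonneg _ := Nat.cast_nonneg _
  size _ := ((L : ℝ) / d) ^ 2
  density := pairClassDensity d
  density_mult := isMultiplicative_pairClassDensity d

/-- **Sums of the sequence over a set of integers count pairs**: for any condition `c`,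
`∑_{k ≤ classBoxTop, c(k)} a_k = #{(x,y) ∈ classBoxPairs : c(x³ + 2y³)}`. [cite: HeathBrownMoroz2004, §2 (2.4)] -/
theorem sum_seqPairBox_a_filter (A A' L d a b : ℕ) (c : ℕ → Prop) [DecidablePred c] :
    ∑ k ∈ (Ioc 0 (classBoxTop A A' L)).filter c, (seqPairBox A A' L d a b).a k =
      #{xy ∈ classBoxPairs A A' L d a b | c (xy.1 ^ 3 + 2 * xy.2 ^ 3)} := by
  classical
  have hmaps : Set.MapsTo (fun xy : ℕ × ℕ => xy.1 ^ 3 + 2 * xy.2 ^ 3)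
      ({xy ∈ classBoxPairs A A' L d a b | c (xy.1 ^ 3 + 2 * xy.2 ^ 3)} : Finset (ℕ × ℕ))
      ((Ioc 0 (classBoxTop A A' L)).filter c) := by
    intro xy hxy
    rw [mem_coe, mem_filter] at hxy ⊢
    exact ⟨value_mem_Ioc_of_mem_classBoxPairs hxy.1, hxy.2⟩
  rw [card_eq_sum_card_fiberwise hmaps, Nat.cast_sum]
  refine sum_congr rfl fun k hk => ?_
  simp only [seqPairBox, filter_filter]
  congr 2
  ext xy
  simp only [mem_filter, and_congr_right_iff]
  intro _
  constructor
  · rintro rfl; exact ⟨(mem_filter.mp hk).2, rfl⟩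
  · rintro ⟨-, rfl⟩; rfl

/-- `S(𝒜, z)` counts the class-box pairs whose value is coprime to `P(z)`. [cite: HeathBrownMoroz2004, §2 (2.4)] -/
theorem sifted_seqPairBox_eq (A A' L d a b : ℕ) (z : ℝ) :
    (seqPairBox A A' L d a b).sifted (classBoxTop A A' L) (primesProdBelow z) =
      #{xy ∈ classBoxPairs A A' L d a b | (xy.1 ^ 3 + 2 * xy.2 ^ 3).Coprime (primesProdBelow z)} := by
  rw [SieveSequence.sifted, Nat.floor_natCast, sum_seqPairBox_a_filter]

/-- `𝒜_q(x) = #{(x,y) ∈ classBoxPairs : q ∣ x³ + 2y³}`. [cite: HeathBrownMoroz2004, §2 (2.4)] -/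
theorem congrSum_seqPairBox_eq (A A' L d a b q : ℕ) :
    (seqPairBox A A' L d a b).congrSum q (classBoxTop A A' L) =
      #{xy ∈ classBoxPairs A A' L d a b | q ∣ xy.1 ^ 3 + 2 * xy.2 ^ 3} := by
  rw [SieveSequence.congrSum, Nat.floor_natCast, sum_seqPairBox_a_filter]

/-! ### The Type-I estimate of the pair sieve (trivial lattice counts) -/

/-- In an admissible class no value is divisible by a prime `p ∣ d`: `x ≡ a`, `y ≡ b (mod p)` give
`x³ + 2y³ ≡ a³ + 2b³ ≢ 0 (mod p)`. [cite: HeathBrownMoroz2004, (2.36)] -/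
theorem not_dvd_value_of_dvd_modulus {d a b p : ℕ} (hp : p.Prime) (hpd : p ∣ d)
    (hab : Nat.Coprime (a ^ 3 + 2 * b ^ 3) d) {x y : ℕ} (hx : x ≡ a [MOD d]) (hy : y ≡ b [MOD d]) :
    ¬ p ∣ x ^ 3 + 2 * y ^ 3 := by
  intro h
  have hx' : x ≡ a [MOD p] := hx.of_dvd hpd
  have hy' : y ≡ b [MOD p] := hy.of_dvd hpd
  have hval : x ^ 3 + 2 * y ^ 3 ≡ a ^ 3 + 2 * b ^ 3 [MOD p] :=
    (hx'.pow 3).add ((hy'.pow 3).mul_left 2)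
  have hab' : p ∣ a ^ 3 + 2 * b ^ 3 := (hval.dvd_iff (dvd_refl p)).mp h
  have : p ∣ Nat.gcd (a ^ 3 + 2 * b ^ 3) d := Nat.dvd_gcd hab' hpd
  rw [hab] at this
  exact hp.not_dvd_one this

/-- `#𝒜_q = 0` as soon as `(q, d) > 1` (admissible class). [cite: HeathBrownMoroz2004, (2.36)] -/
theorem congrSum_seqPairBox_eq_zero {A A' L d a b q : ℕ} (hab : Nat.Coprime (a ^ 3 + 2 * b ^ 3) d)
    (hqd : ¬ q.Coprime d) :
    (seqPairBox A A' L d a b).congrSum q (classBoxTop A A' L) = 0 := by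
  rw [congrSum_seqPairBox_eq, Nat.cast_eq_zero, card_eq_zero, filter_eq_empty_iff]
  intro xy hxy hq
  obtain ⟨p, hp, hpq, hpd⟩ := Nat.Prime.not_coprime_iff_dvd.mp hqd
  obtain ⟨-, hx, -, hy⟩ := mem_classBoxPairs_iff.mp hxy
  exact not_dvd_value_of_dvd_modulus hp hpd hab hx hy (hpq.trans hq)

/-- `g_d(q) = 0` as soon as `(q, d) > 1`, `q ≠ 0`. [cite: HeathBrownMoroz2004, (2.36)] -/
theorem pairClassDensity_eq_zero {d q : ℕ} (hq : q ≠ 0) (hqd : ¬ q.Coprime d) :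
    pairClassDensity d q = 0 := by
  obtain ⟨p, hp, hpq, hpd⟩ := Nat.Prime.not_coprime_iff_dvd.mp hqd
  rw [pairClassDensity_apply d hq]
  exact prod_eq_zero (Nat.mem_primeFactors.mpr ⟨hp, hpq, hq⟩) (if_pos hpd)

/-- `g_d(q) = ω(q)/q²` for square-free `q` coprime to `d`. [cite: HeathBrownMoroz2004, Lemma 2.4] -/
theorem pairClassDensity_eq_of_coprime {d q : ℕ} (hq : Squarefree q) (hqd : q.Coprime d) :
    pairClassDensity d q = (pairZeroCount q : ℝ) / (q : ℝ) ^ 2 := by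
  have hq0 : q ≠ 0 := hq.ne_zero
  rw [pairClassDensity_apply d hq0, pairZeroCount_of_squarefree hq, Nat.cast_prod]
  have hterm : ∀ p ∈ q.primeFactors, (if p ∣ d then (0 : ℝ) else (pairZeroCount p : ℝ) / (p : ℝ) ^ 2) =
      (pairZeroCount p : ℝ) / (p : ℝ) ^ 2 := by
    intro p hp
    have hpq : p ∣ q := Nat.dvd_of_mem_primeFactors hp
    have hpd : ¬ p ∣ d := fun h => (Nat.prime_of_mem_primeFactors hp).ne_one
      (Nat.eq_one_of_dvd_coprimes hqd hpq h)
    rw [if_neg hpd]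
  have hden : (∏ x ∈ q.primeFactors, (x : ℝ)) = q := by
    rw [← Nat.cast_prod, Nat.prod_primeFactors_of_squarefree hq]
  rw [prod_congr rfl hterm, prod_div_distrib, prod_pow, hden]

/-- The residue pairs `(u, v) (mod q)` removed by the sieve. [cite: HeathBrownMoroz2004, §2 (2.3)] -/
private def zeroPairsMod (q : ℕ) : Finset (ℕ × ℕ) :=
  {uv ∈ range q ×ˢ range q | q ∣ uv.1 ^ 3 + 2 * uv.2 ^ 3}

/-- `#zeroPairsMod q = ω(q)` (private helper). [folklore] -/
private theorem card_zeroPairsMod (q : ℕ) : #(zeroPairsMod q) = pairZeroCount q := rfl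

/-- `q ∣ x³ + 2y³ ⟺ q ∣ (x mod q)³ + 2(y mod q)³`. [folklore] -/
private theorem dvd_value_iff_dvd_mod (q x y : ℕ) :
    q ∣ x ^ 3 + 2 * y ^ 3 ↔ q ∣ (x % q) ^ 3 + 2 * (y % q) ^ 3 := by
  have hx : x % q ≡ x [MOD q] := Nat.mod_modEq x q
  have hy : y % q ≡ y [MOD q] := Nat.mod_modEq y q
  exact ((hx.pow 3).add ((hy.pow 3).mul_left 2)).symm.dvd_iff (dvd_refl q)

/-- **Splitting `#𝒜_q` over the residue pairs** ((2.3)–(2.4)):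
`#𝒜_q = ∑_{(u,v) mod q, q ∣ u³+2v³} #{(x,y) ∈ classBoxPairs : x ≡ u, y ≡ v (mod q)}`.
[cite: HeathBrownMoroz2004, §2 (2.3)–(2.4)] -/
private theorem card_filter_dvd_eq_sum {q : ℕ} (hq : 0 < q) (A A' L d a b : ℕ) :
    #{xy ∈ classBoxPairs A A' L d a b | q ∣ xy.1 ^ 3 + 2 * xy.2 ^ 3} =
      ∑ uv ∈ zeroPairsMod q,
        #{x ∈ Ioc A (A + L) | x ≡ a [MOD d] ∧ x ≡ uv.1 [MOD q]} *
          #{y ∈ Ioc A' (A' + L) | y ≡ b [MOD d] ∧ y ≡ uv.2 [MOD q]} := by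
  classical
  have hmaps : Set.MapsTo (fun xy : ℕ × ℕ => (xy.1 % q, xy.2 % q))
      ({xy ∈ classBoxPairs A A' L d a b | q ∣ xy.1 ^ 3 + 2 * xy.2 ^ 3} : Finset (ℕ × ℕ))
      (zeroPairsMod q) := by
    intro xy hxy
    rw [mem_coe, mem_filter] at hxy
    rw [mem_coe, zeroPairsMod, mem_filter, mem_product, mem_range, mem_range]
    exact ⟨⟨Nat.mod_lt _ hq, Nat.mod_lt _ hq⟩, (dvd_value_iff_dvd_mod q _ _).mp hxy.2⟩
  rw [card_eq_sum_card_fiberwise hmaps]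
  refine sum_congr rfl fun uv huv => ?_
  obtain ⟨u, v⟩ := uv
  rw [zeroPairsMod, mem_filter, mem_product, mem_range, mem_range] at huv
  obtain ⟨⟨hu, hv⟩, hdvd⟩ := huv
  rw [← card_product, ← filter_product]
  congr 1
  ext ⟨x, y⟩
  simp only [mem_filter, mem_classBoxPairs_iff, mem_product, mem_Ioc, Prod.mk.injEq, Nat.ModEq,
    Nat.mod_eq_of_lt hu, Nat.mod_eq_of_lt hv]
  constructor
  · rintro ⟨⟨⟨hx, hxa, hy, hyb⟩, -⟩, hxu, hyv⟩
    exact ⟨⟨hx, hy⟩, ⟨hxa, hxu⟩, hyb, hyv⟩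
  · rintro ⟨⟨hx, hy⟩, ⟨hxa, hxu⟩, hyb, hyv⟩
    refine ⟨⟨⟨hx, hxa, hy, hyb⟩, ?_⟩, hxu, hyv⟩
    rw [dvd_value_iff_dvd_mod, hxu, hyv]
    exact hdvd

/-- Product of two counts each within `1` of `t ≥ 0`: `|n₁ n₂ − t²| ≤ 2t + 1`. [folklore] -/
private theorem abs_mul_sub_sq_le {n₁ n₂ t : ℝ} (h₁ : |n₁ - t| ≤ 1) (h₂ : |n₂ - t| ≤ 1) (ht : 0 ≤ t) :
    |n₁ * n₂ - t ^ 2| ≤ 2 * t + 1 := by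
  have e : n₁ * n₂ - t ^ 2 = (n₁ - t) * (n₂ - t) + t * (n₁ - t) + t * (n₂ - t) := by ring
  rw [e]
  have h3 : |(n₁ - t) * (n₂ - t)| ≤ 1 := by
    rw [abs_mul]
    calc |n₁ - t| * |n₂ - t| ≤ 1 * 1 := mul_le_mul h₁ h₂ (abs_nonneg _) zero_le_one
      _ = 1 := one_mul 1
  have h4 : |t * (n₁ - t)| ≤ t := by
    rw [abs_mul, abs_of_nonneg ht]
    calc t * |n₁ - t| ≤ t * 1 := mul_le_mul_of_nonneg_left h₁ ht
      _ = t := mul_one t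
  have h5 : |t * (n₂ - t)| ≤ t := by
    rw [abs_mul, abs_of_nonneg ht]
    calc t * |n₂ - t| ≤ t * 1 := mul_le_mul_of_nonneg_left h₂ ht
      _ = t := mul_one t
  calc |(n₁ - t) * (n₂ - t) + t * (n₁ - t) + t * (n₂ - t)|
      ≤ |(n₁ - t) * (n₂ - t) + t * (n₁ - t)| + |t * (n₂ - t)| := abs_add_le _ _
    _ ≤ (|(n₁ - t) * (n₂ - t)| + |t * (n₁ - t)|) + |t * (n₂ - t)| := by
        gcongr; exact abs_add_le _ _
    _ ≤ 1 + t + t := by linarith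
    _ = 2 * t + 1 := by ring

/-- **The Type-I estimate of the pair sieve** (trivial lattice counts): for `d, q ≥ 1` coprime,
`|#𝒜_q − ω(q)·(L/(dq))²| ≤ ω(q)·(2L/(dq) + 1)`. [cite: HalberstamRichert1974, Thm 2.2 (the remainder `|R_d| ≤ 1` of an arithmetic progression)] -/
theorem abs_congrSum_seqPairBox_sub_le {d q : ℕ} (hd : 0 < d) (hq : 0 < q) (hqd : q.Coprime d)
    (A A' L a b : ℕ) :
    |(seqPairBox A A' L d a b).congrSum q (classBoxTop A A' L) -
        pairZeroCount q * ((L : ℝ) / (d * q)) ^ 2| ≤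
      pairZeroCount q * (2 * ((L : ℝ) / (d * q)) + 1) := by
  set t : ℝ := (L : ℝ) / (d * q) with ht
  have hconst : ∀ T : ℝ, (pairZeroCount q : ℝ) * T = ∑ _uv ∈ zeroPairsMod q, T := fun T => by
    rw [sum_const, nsmul_eq_mul, card_zeroPairsMod]
  rw [congrSum_seqPairBox_eq, card_filter_dvd_eq_sum hq, Nat.cast_sum, hconst, hconst,
    ← sum_sub_distrib]
  refine (abs_sum_le_sum_abs _ _).trans (sum_le_sum fun uv _ => ?_)
  rw [Nat.cast_mul]
  exact abs_mul_sub_sq_le (abs_card_Ioc_filter_modEq_and_sub_le hd hq hqd.symm A L a uv.1)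
    (abs_card_Ioc_filter_modEq_and_sub_le hd hq hqd.symm A' L b uv.2) (by positivity)

/-- **The remainders of the pair sieve**: for an admissible class and a square-free `q`,
`|R_q| = |#𝒜_q − g_d(q)(L/d)²| ≤ τ(q)² (2L/d + q)` (`= 0` if `(q, d) > 1`).
[cite: HalberstamRichert1974, Thm 2.2 (the remainder `|R_d| ≤ 1` of an arithmetic progression)] -/
theorem abs_remainder_seqPairBox_le {d a b : ℕ} (hd : 0 < d) (hab : Nat.Coprime (a ^ 3 + 2 * b ^ 3) d)
    (A A' L : ℕ) {q : ℕ} (hq : Squarefree q) :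
    |(seqPairBox A A' L d a b).remainder q (classBoxTop A A' L)| ≤
      (#q.divisors : ℝ) ^ 2 * (2 * ((L : ℝ) / d) + q) := by
  have hq0 : q ≠ 0 := hq.ne_zero
  have hqpos : 0 < q := Nat.pos_of_ne_zero hq0
  have hq1 : (1 : ℝ) ≤ q := by exact_mod_cast hqpos
  have hRHS : 0 ≤ (#q.divisors : ℝ) ^ 2 * (2 * ((L : ℝ) / d) + q) := by positivity
  rw [SieveSequence.remainder]
  change |(seqPairBox A A' L d a b).congrSum q (classBoxTop A A' L) -
      pairClassDensity d q * ((L : ℝ) / d) ^ 2| ≤ _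
  by_cases hqd : q.Coprime d
  · rw [pairClassDensity_eq_of_coprime hq hqd]
    have h := abs_congrSum_seqPairBox_sub_le hd hqpos hqd A A' L a b
    have hqR : (q : ℝ) ≠ 0 := by positivity
    have hdR : (d : ℝ) ≠ 0 := by exact_mod_cast hd.ne'
    have e1 : (pairZeroCount q : ℝ) / (q : ℝ) ^ 2 * ((L : ℝ) / d) ^ 2 =
        pairZeroCount q * ((L : ℝ) / (d * q)) ^ 2 := by
      field_simp
    rw [e1]
    refine h.trans ?_
    have hω := pairZeroCount_le_card_divisors_sq_mul hq
    have hω0 : (0 : ℝ) ≤ pairZeroCount q := Nat.cast_nonneg _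
    have hL : (0 : ℝ) ≤ (L : ℝ) / d := by positivity
    have e2 : 2 * ((L : ℝ) / (d * q)) + 1 = (2 * ((L : ℝ) / d) + q) / q := by
      field_simp
    rw [e2]
    calc (pairZeroCount q : ℝ) * ((2 * ((L : ℝ) / d) + q) / q)
        ≤ ((#q.divisors : ℝ) ^ 2 * q) * ((2 * ((L : ℝ) / d) + q) / q) :=
          mul_le_mul_of_nonneg_right hω (by positivity)
      _ = (#q.divisors : ℝ) ^ 2 * (2 * ((L : ℝ) / d) + q) := by field_simp
  · rw [congrSum_seqPairBox_eq_zero hab hqd, pairClassDensity_eq_zero hq0 hqd]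
    simpa using hRHS

/-- **The remainder sum of the pair sieve**: `∑_{q ∣ P(z), q ≤ D} |R_q| ≤ C (L/d + D) D (log D)^8` for
`D ≥ 2`, by `∑_{q ≤ D} τ(q)² ≪ D (log D)^8` (`DivisorPowerSums`). [cite: HalberstamRichert1974, Thm 2.2 (the remainder `|R_d| ≤ 1` of an arithmetic progression)] -/
theorem exists_sum_abs_remainder_seqPairBox_le :
    ∃ C : ℝ, 0 < C ∧ ∀ (A A' L d a b : ℕ) (z D : ℝ), 0 < d → Nat.Coprime (a ^ 3 + 2 * b ^ 3) d → 2 ≤ D →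
      ∑ q ∈ (primesProdBelow z).divisors.filter (fun q : ℕ => (q : ℝ) ≤ D),
          |(seqPairBox A A' L d a b).remainder q (classBoxTop A A' L)| ≤
        C * ((L : ℝ) / d + D) * D * Real.log D ^ 8 := by
  obtain ⟨C, hC, hsum⟩ := exists_sum_sigma_zero_pow_le_real 2
  refine ⟨2 * C, by positivity, fun A A' L d a b z D hd hab hD => ?_⟩
  have hD0 : 0 ≤ D := by linarith
  have hLd : (0 : ℝ) ≤ (L : ℝ) / d := by positivity
  have hlog : 0 ≤ Real.log D := Real.log_nonneg (by linarith)
  have hsum' : ∑ q ∈ Icc 1 ⌊D⌋₊, (#q.divisors : ℝ) ^ 2 ≤ C * D * Real.log D ^ 8 := by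
    have h := hsum D hD
    simp only [ArithmeticFunction.sigma_zero_apply] at h
    norm_num at h
    exact h
  set S := (primesProdBelow z).divisors.filter (fun q : ℕ => (q : ℝ) ≤ D) with hS
  have hmem : ∀ q ∈ S, Squarefree q ∧ (q : ℝ) ≤ D ∧ q ∈ Icc 1 ⌊D⌋₊ := by
    intro q hq
    rw [hS, mem_filter] at hq
    have hdvd := Nat.dvd_of_mem_divisors hq.1
    refine ⟨(squarefree_primesProdBelow z).squarefree_of_dvd hdvd, hq.2, ?_⟩
    rw [mem_Icc]
    exact ⟨Nat.pos_of_mem_divisors hq.1, Nat.le_floor hq.2⟩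
  have hsub : S ⊆ Icc 1 ⌊D⌋₊ := fun q hq => (hmem q hq).2.2
  have step1 : ∑ q ∈ S, |(seqPairBox A A' L d a b).remainder q (classBoxTop A A' L)| ≤
      ∑ q ∈ S, (#q.divisors : ℝ) ^ 2 * (2 * ((L : ℝ) / d) + D) := by
    refine sum_le_sum fun q hq => ?_
    obtain ⟨hsq, hqD, -⟩ := hmem q hq
    refine (abs_remainder_seqPairBox_le hd hab A A' L hsq).trans ?_
    exact mul_le_mul_of_nonneg_left (by linarith) (sq_nonneg _)
  have step2 : ∑ q ∈ S, (#q.divisors : ℝ) ^ 2 ≤ ∑ q ∈ Icc 1 ⌊D⌋₊, (#q.divisors : ℝ) ^ 2 :=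
    sum_le_sum_of_subset_of_nonneg hsub fun q _ _ => sq_nonneg _
  have hF0 : 0 ≤ 2 * ((L : ℝ) / d) + D := by positivity
  calc ∑ q ∈ S, |(seqPairBox A A' L d a b).remainder q (classBoxTop A A' L)|
      ≤ ∑ q ∈ S, (#q.divisors : ℝ) ^ 2 * (2 * ((L : ℝ) / d) + D) := step1
    _ = (∑ q ∈ S, (#q.divisors : ℝ) ^ 2) * (2 * ((L : ℝ) / d) + D) := by rw [sum_mul]
    _ ≤ (C * D * Real.log D ^ 8) * (2 * ((L : ℝ) / d) + D) :=
        mul_le_mul_of_nonneg_right (step2.trans hsum') hF0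
    _ ≤ 2 * C * ((L : ℝ) / d + D) * D * Real.log D ^ 8 := by
        have : 0 ≤ C * D * Real.log D ^ 8 * D := by positivity
        nlinarith

/-! ### The main term: `V(z) ≤ 𝔈(d) · ∏_{p<z}(1 − ν_p/(p+1))` -/

/-- **The pair-sieve product is at most the class-enhanced Heath-Brown product**:
`V(z) = ∏_{p<z}(1 − g_d(p)) ≤ E_z(d) · ∏_{p<z}(1 − ν_p/(p+1)) ≤ coprimeClassWeight d · prodA z`.
[cite: HeathBrownMoroz2004, §3 (3.1)] -/
theorem densityProduct_seqPairBox_le {d : ℕ} (hd : d ≠ 0) (A A' L a b : ℕ) (z : ℝ) :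
    (seqPairBox A A' L d a b).densityProduct (primesProdBelow z) ≤ coprimeClassWeight d * prodA z := by
  classical
  have h1 : (seqPairBox A A' L d a b).densityProduct (primesProdBelow z) ≤
      classEnhancementBelow z d * prodA z := by
    rw [SieveSequence.densityProduct, primeFactors_primesProdBelow, classEnhancementBelow, prodA,
      prod_filter, ← prod_mul_distrib]
    refine prod_le_prod (fun p hp => ?_) fun p hp => ?_
    · have hb := (pairClassDensity_prime_bounds d (Nat.prime_of_mem_primesBelow hp)).2.2
      change 0 ≤ 1 - pairClassDensity d p
      linarith
    · exact one_sub_pairClassDensity_le d (Nat.prime_of_mem_primesBelow hp)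
  exact h1.trans (mul_le_mul_of_nonneg_right (classEnhancementBelow_le z hd) (prodA_pos_le z).1.le)

/-- `V(z) ≥ 0`. [cite: HeathBrownMoroz2004, §3 (3.1)] -/
theorem densityProduct_seqPairBox_nonneg (A A' L d a b : ℕ) (z : ℝ) :
    0 ≤ (seqPairBox A A' L d a b).densityProduct (primesProdBelow z) := by
  rw [SieveSequence.densityProduct]
  refine prod_nonneg fun p hp => ?_
  have hb := (pairClassDensity_prime_bounds d (Nat.prime_of_mem_primeFactors hp)).2.2
  change 0 ≤ 1 - pairClassDensity d p
  linarith

/-- `coprimeClassWeight d ≥ 1`. [cite: HeathBrownMoroz2004, §3 (3.1)] -/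
theorem one_le_coprimeClassWeight (d : ℕ) : 1 ≤ coprimeClassWeight d := by
  rw [coprimeClassWeight]
  have hge1 : ∀ p ∈ d.primeFactors, (1 : ℝ) ≤ ((p : ℝ) + 1) / ((p : ℝ) + 1 - cubeRootTwoCount p) := by
    intro p hp
    have hpp : p.Prime := Nat.prime_of_mem_primeFactors hp
    rw [le_div_iff₀ (cast_add_one_sub_cubeRootTwoCount_pos hpp), one_mul]
    linarith [(Nat.cast_nonneg (cubeRootTwoCount p) : (0 : ℝ) ≤ _)]
  calc (1 : ℝ) = ∏ _p ∈ d.primeFactors, (1 : ℝ) := prod_const_one.symm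
    _ ≤ _ := prod_le_prod (fun _ _ => zero_le_one) hge1

/-! ### The Brun–Titchmarsh bound -/

/-- **The Fundamental Lemma applied to the pair sieve** at `D = z`: there is an absolute `K` such that
for every admissible class, every box and every `z ≥ 2`,
`#{(x,y) ∈ classBoxPairs : (x³+2y³, P(z)) = 1} ≤ K · 𝔈(d) (L/d)² ∏_{p<z}(1 − ν_p/(p+1)) + K (L/d + z) z (log z)^8`.
[cite: HalberstamRichert1974, Thm 2.5 (Fundamental Lemma) with Thm 2.2] -/
theorem exists_card_rough_le_sieve :
    ∃ K : ℝ, 0 < K ∧ ∀ (A A' L d a b : ℕ) (z : ℝ), 0 < d → Nat.Coprime (a ^ 3 + 2 * b ^ 3) d → 2 ≤ z →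
      (#{xy ∈ classBoxPairs A A' L d a b | (xy.1 ^ 3 + 2 * xy.2 ^ 3).Coprime (primesProdBelow z)} : ℝ) ≤
        K * (coprimeClassWeight d * ((L : ℝ) / d) ^ 2 * prodA z) +
          K * (((L : ℝ) / d + z) * z * Real.log z ^ 8) := by
  obtain ⟨C₁, hC₁, hFL⟩ := SieveSequence.fundamental_lemma_uniform_holds 3 dimConst
  obtain ⟨C₂, hC₂, hR⟩ := exists_sum_abs_remainder_seqPairBox_le
  refine ⟨max (1 + C₁) C₂, by positivity, fun A A' L d a b z hd hab hz => ?_⟩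
  set 𝒜 := seqPairBox A A' L d a b with h𝒜
  have hsize : ∀ x, 𝒜.size x = ((L : ℝ) / d) ^ 2 := fun _ => rfl
  have hX : 0 ≤ 𝒜.size (classBoxTop A A' L : ℝ) := by rw [hsize]; positivity
  have h := hFL 𝒜 (hasSieveDimension_pairClassDensity d) (classBoxTop A A' L : ℝ) z z hz le_rfl hX
  have hlogz : 0 < Real.log z := Real.log_pos (by linarith)
  have he : Real.exp (-(Real.log z / Real.log z)) ≤ 1 := by
    rw [div_self hlogz.ne']; exact (Real.exp_le_one_iff.mpr (by norm_num))
  have hV0 := densityProduct_seqPairBox_nonneg A A' L d a b z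
  have hVle := densityProduct_seqPairBox_le hd.ne' A A' L a b z
  have hrem := hR A A' L d a b z z hd hab hz
  rw [← sifted_seqPairBox_eq]
  have hup := (abs_le.mp h).2
  set S := 𝒜.sifted (classBoxTop A A' L : ℝ) (primesProdBelow z)
  set V := 𝒜.densityProduct (primesProdBelow z)
  have hXV : 0 ≤ 𝒜.size (classBoxTop A A' L : ℝ) * V := mul_nonneg hX hV0
  have hW : 0 ≤ coprimeClassWeight d := le_trans zero_le_one (one_le_coprimeClassWeight d)
  have hmain : 𝒜.size (classBoxTop A A' L : ℝ) * V ≤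
      coprimeClassWeight d * ((L : ℝ) / d) ^ 2 * prodA z := by
    rw [hsize]
    calc ((L : ℝ) / d) ^ 2 * V ≤ ((L : ℝ) / d) ^ 2 * (coprimeClassWeight d * prodA z) :=
          mul_le_mul_of_nonneg_left hVle (by positivity)
      _ = _ := by ring
  have hm1 : (1 + C₁) ≤ max (1 + C₁) C₂ := le_max_left _ _
  have hm2 : C₂ ≤ max (1 + C₁) C₂ := le_max_right _ _
  have hP0 : 0 ≤ coprimeClassWeight d * ((L : ℝ) / d) ^ 2 * prodA z :=
    mul_nonneg (mul_nonneg hW (by positivity)) (prodA_pos_le z).1.le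
  have hQ0 : 0 ≤ ((L : ℝ) / d + z) * z * Real.log z ^ 8 := by positivity
  set XV := 𝒜.size (classBoxTop A A' L : ℝ) * V with hXVdef
  have h1 : C₁ * 𝒜.size (classBoxTop A A' L : ℝ) * V * Real.exp (-(Real.log z / Real.log z)) ≤
      C₁ * XV := by
    rw [show C₁ * 𝒜.size (classBoxTop A A' L : ℝ) * V = C₁ * XV by rw [hXVdef]; ring]
    exact mul_le_of_le_one_right (by positivity) he
  have h2 : S ≤ (1 + C₁) * XV + C₂ * (((L : ℝ) / d + z) * z * Real.log z ^ 8) := by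
    have := hrem
    nlinarith [hup, h1]
  calc S ≤ (1 + C₁) * XV + C₂ * (((L : ℝ) / d + z) * z * Real.log z ^ 8) := h2
    _ ≤ (1 + C₁) * (coprimeClassWeight d * ((L : ℝ) / d) ^ 2 * prodA z) +
          C₂ * (((L : ℝ) / d + z) * z * Real.log z ^ 8) := by
        gcongr
    _ ≤ max (1 + C₁) C₂ * (coprimeClassWeight d * ((L : ℝ) / d) ^ 2 * prodA z) +
          max (1 + C₁) C₂ * (((L : ℝ) / d + z) * z * Real.log z ^ 8) :=
        add_le_add (mul_le_mul_of_nonneg_right hm1 hP0) (mul_le_mul_of_nonneg_right hm2 hQ0)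

/-- **Brun–Titchmarsh for the values of `x³ + 2y³` on a class of pairs, sifted form**: there are
absolute `C, L₀` such that for every box of side `L`, every `d ≥ 1`, every admissible class
`(a, b) (mod d)` with `L/d ≥ L₀`, the class-box pairs whose value has no prime factor below
`(L/d)^{1/2}` number at most `C · 𝔈(d) · (L/d)²/log(L/d)`. (Sieve at `z = D = (L/d)^{1/2}`, Mertens'
bound `∏_{p<z}(1 − ν_p/(p+1)) ≤ C′/log z`, and `(L/d)^{3/2} log⁸ = o((L/d)²/log)`.)
[cite: HalberstamRichert1974, Thm 3.7 (Brun–Titchmarsh), via Thm 2.2 / Thm 2.5] -/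
theorem card_classBoxPairs_rough_le :
    ∃ C L₀ : ℝ, 0 < C ∧ ∀ (A A' L d a b : ℕ), 0 < d → Nat.Coprime (a ^ 3 + 2 * b ^ 3) d →
      L₀ ≤ (L : ℝ) / d →
      (#{xy ∈ classBoxPairs A A' L d a b |
          (xy.1 ^ 3 + 2 * xy.2 ^ 3).Coprime (primesProdBelow (Real.sqrt ((L : ℝ) / d)))} : ℝ) ≤
        C * coprimeClassWeight d * ((L : ℝ) / d) ^ 2 / Real.log ((L : ℝ) / d) := by
  obtain ⟨K, hK, hsieve⟩ := exists_card_rough_le_sieve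
  obtain ⟨C₂, z₂, hC₂, hprod⟩ := CubicSieve.exists_prodA_le HeathBrown2001_singularProduct_holds.choose_spec.2
  -- eventual conditions in `t = L/d`: `√t ≥ max 2 z₂`, and `t^{3/2} (log √t)^8 · (2 log t) ≤ t²`
  have hev₁ : ∀ᶠ t : ℝ in atTop, max 2 z₂ ^ 2 ≤ t := eventually_ge_atTop _
  have hev₂ : ∀ᶠ t : ℝ in atTop, ‖Real.log t ^ (9 : ℝ)‖ ≤ 1 * ‖t ^ (1 / 2 : ℝ)‖ :=
    (isLittleO_log_rpow_rpow_atTop 9 (by norm_num : (0 : ℝ) < 1 / 2)).bound one_pos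
  have hev₃ : ∀ᶠ t : ℝ in atTop, Real.exp 1 ≤ t := eventually_ge_atTop _
  obtain ⟨L₀, hL₀⟩ := Filter.eventually_atTop.mp (hev₁.and (hev₂.and hev₃))
  refine ⟨4 * K * C₂ + 4 * K, L₀, by positivity, fun A A' L d a b hd hab hLd => ?_⟩
  obtain ⟨ht1, ht2, ht3⟩ := hL₀ ((L : ℝ) / d) hLd
  set t : ℝ := (L : ℝ) / d with ht
  have he1 : 1 ≤ Real.exp 1 := Real.one_le_exp (by norm_num)
  have ht_one : 1 ≤ t := le_trans he1 ht3
  have ht0 : 0 < t := by linarith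
  have hlogt : 1 ≤ Real.log t := by
    rw [← Real.log_exp 1]; exact Real.log_le_log (Real.exp_pos 1) ht3
  have hlogt0 : 0 < Real.log t := by linarith
  set z : ℝ := Real.sqrt t with hz
  have hz0 : 0 ≤ z := Real.sqrt_nonneg t
  have hzsq : z ^ 2 = t := Real.sq_sqrt ht0.le
  have hmz : max 2 z₂ ≤ z := by
    rw [hz, ← Real.sqrt_sq (le_trans (by norm_num) (le_max_left 2 z₂) : (0 : ℝ) ≤ max 2 z₂)]
    exact Real.sqrt_le_sqrt ht1
  have hz2 : 2 ≤ z := le_trans (le_max_left _ _) hmz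
  have hzz₂ : z₂ ≤ z := le_trans (le_max_right _ _) hmz
  have hlogz : Real.log z = Real.log t / 2 := by
    rw [hz, Real.log_sqrt ht0.le]
  have hmain := hsieve A A' L d a b z hd hab hz2
  have hpz := hprod z hzz₂
  have hW : 1 ≤ coprimeClassWeight d := one_le_coprimeClassWeight d
  have hW0 : 0 ≤ coprimeClassWeight d := le_trans zero_le_one hW
  -- main term
  have hA : K * (coprimeClassWeight d * t ^ 2 * prodA z) ≤
      2 * K * C₂ * coprimeClassWeight d * t ^ 2 / Real.log t := by
    rw [hlogz] at hpz
    have : prodA z ≤ 2 * C₂ / Real.log t := by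
      calc prodA z ≤ C₂ / (Real.log t / 2) := hpz
        _ = 2 * C₂ / Real.log t := by field_simp
    calc K * (coprimeClassWeight d * t ^ 2 * prodA z)
        ≤ K * (coprimeClassWeight d * t ^ 2 * (2 * C₂ / Real.log t)) := by gcongr
      _ = 2 * K * C₂ * coprimeClassWeight d * t ^ 2 / Real.log t := by
          field_simp
  -- remainder term: `(t + z) z (log z)^8 ≤ 2 t^{3/2} (log t)^8 ≤ 2 t² / log t`
  have hlog9 : Real.log t ^ (9 : ℝ) ≤ t ^ (1 / 2 : ℝ) := by
    have h := ht2
    rw [one_mul, Real.norm_of_nonneg (Real.rpow_nonneg hlogt0.le _),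
      Real.norm_of_nonneg (Real.rpow_nonneg ht0.le _)] at h
    exact h
  have hzt : z = t ^ (1 / 2 : ℝ) := by rw [hz, Real.sqrt_eq_rpow]
  have hlog9' : Real.log t ^ 9 = Real.log t ^ (9 : ℝ) := by
    rw [← Real.rpow_natCast]; norm_num
  have hB : K * ((t + z) * z * Real.log z ^ 8) ≤ 2 * K * coprimeClassWeight d * t ^ 2 / Real.log t := by
    have hzt' : z ≤ t := by nlinarith
    have hlz : Real.log z ≤ Real.log t := by rw [hlogz]; linarith
    have hlz0 : 0 ≤ Real.log z := by rw [hlogz]; linarith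
    have h1 : (t + z) * z * Real.log z ^ 8 ≤ 2 * t * z * Real.log t ^ 8 := by
      have : Real.log z ^ 8 ≤ Real.log t ^ 8 := pow_le_pow_left₀ hlz0 hlz 8
      calc (t + z) * z * Real.log z ^ 8 ≤ (t + t) * z * Real.log t ^ 8 := by gcongr
        _ = 2 * t * z * Real.log t ^ 8 := by ring
    -- `z log^9 t ≤ z · t^{1/2} = t`
    have h2 : z * Real.log t ^ 9 ≤ t := by
      rw [hlog9', hzt]
      calc t ^ (1 / 2 : ℝ) * Real.log t ^ (9 : ℝ) ≤ t ^ (1 / 2 : ℝ) * t ^ (1 / 2 : ℝ) :=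
            mul_le_mul_of_nonneg_left hlog9 (Real.rpow_nonneg ht0.le _)
        _ = t := by rw [← Real.rpow_add ht0]; norm_num
    have h3 : 2 * t * z * Real.log t ^ 8 ≤ 2 * t ^ 2 / Real.log t := by
      rw [le_div_iff₀ hlogt0]
      have : 2 * t * z * Real.log t ^ 8 * Real.log t = 2 * t * (z * Real.log t ^ 9) := by ring
      rw [this]
      nlinarith
    calc K * ((t + z) * z * Real.log z ^ 8) ≤ K * (2 * t ^ 2 / Real.log t) := by
          exact mul_le_mul_of_nonneg_left (h1.trans h3) hK.le
      _ = 2 * K * 1 * t ^ 2 / Real.log t := by ring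
      _ ≤ 2 * K * coprimeClassWeight d * t ^ 2 / Real.log t := by
          gcongr
  calc _ ≤ K * (coprimeClassWeight d * t ^ 2 * prodA z) + K * ((t + z) * z * Real.log z ^ 8) := hmain
    _ ≤ 2 * K * C₂ * coprimeClassWeight d * t ^ 2 / Real.log t +
          2 * K * coprimeClassWeight d * t ^ 2 / Real.log t := add_le_add hA hB
    _ ≤ (4 * K * C₂ + 4 * K) * coprimeClassWeight d * t ^ 2 / Real.log t := by
        rw [← add_div]
        refine div_le_div_of_nonneg_right ?_ hlogt0.le
        have : 0 ≤ K * C₂ * coprimeClassWeight d * t ^ 2 := by positivity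
        have : 0 ≤ K * coprimeClassWeight d * t ^ 2 := by positivity
        nlinarith

/-- A prime value is either `z`-rough (coprime to `P(z)`) or `< z`: for any finite set of pairs,
`#{prime value} ≤ #{value coprime to P(z)} + #{value < z}`. [folklore] -/
private theorem card_filter_prime_le (S : Finset (ℕ × ℕ)) (z : ℝ) :
    #(S.filter (fun xy => (xy.1 ^ 3 + 2 * xy.2 ^ 3).Prime)) ≤
      #(S.filter (fun xy => (xy.1 ^ 3 + 2 * xy.2 ^ 3).Coprime (primesProdBelow z))) +
        #(S.filter (fun xy => ((xy.1 ^ 3 + 2 * xy.2 ^ 3 : ℕ) : ℝ) < z)) := by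
  refine (card_le_card fun xy hxy => ?_).trans (card_union_le _ _)
  rw [mem_filter] at hxy
  rw [mem_union, mem_filter, mem_filter]
  by_cases hlt : ((xy.1 ^ 3 + 2 * xy.2 ^ 3 : ℕ) : ℝ) < z
  · exact Or.inr ⟨hxy.1, hlt⟩
  · refine Or.inl ⟨hxy.1, ?_⟩
    rw [coprime_primesProdBelow_iff]
    intro q hq hqd
    rw [Nat.mem_primesBelow] at hq
    have hqv : q = xy.1 ^ 3 + 2 * xy.2 ^ 3 :=
      ((Nat.dvd_prime hxy.2).mp hqd).resolve_left hq.2.ne_one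
    have hqz : (q : ℝ) < z := Nat.lt_ceil.mp hq.1
    rw [hqv] at hqz
    exact hlt hqz

/-- The pairs with value `< z` have both coordinates `< z`, hence number at most `⌈z⌉²`. [folklore] -/
private theorem card_filter_value_lt_le (S : Finset (ℕ × ℕ)) (z : ℝ) :
    #(S.filter (fun xy => ((xy.1 ^ 3 + 2 * xy.2 ^ 3 : ℕ) : ℝ) < z)) ≤ ⌈z⌉₊ * ⌈z⌉₊ := by
  have hsub : S.filter (fun xy => ((xy.1 ^ 3 + 2 * xy.2 ^ 3 : ℕ) : ℝ) < z) ⊆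
      range ⌈z⌉₊ ×ˢ range ⌈z⌉₊ := by
    intro xy hxy
    rw [mem_filter] at hxy
    obtain ⟨-, hlt⟩ := hxy
    have hx : xy.1 ≤ xy.1 ^ 3 + 2 * xy.2 ^ 3 :=
      (Nat.le_self_pow three_ne_zero xy.1).trans (Nat.le_add_right _ _)
    have hy : xy.2 ≤ xy.1 ^ 3 + 2 * xy.2 ^ 3 :=
      (Nat.le_self_pow three_ne_zero xy.2).trans
        ((Nat.le_mul_of_pos_left _ two_pos).trans (Nat.le_add_left _ _))
    have hx' : (xy.1 : ℝ) < z := lt_of_le_of_lt (Nat.cast_le.mpr hx) hlt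
    have hy' : (xy.2 : ℝ) < z := lt_of_le_of_lt (Nat.cast_le.mpr hy) hlt
    rw [mem_product, mem_range, mem_range, Nat.lt_ceil, Nat.lt_ceil]
    exact ⟨hx', hy'⟩
  calc #(S.filter (fun xy => ((xy.1 ^ 3 + 2 * xy.2 ^ 3 : ℕ) : ℝ) < z))
      ≤ #(range ⌈z⌉₊ ×ˢ range ⌈z⌉₊) := card_le_card hsub
    _ = ⌈z⌉₊ * ⌈z⌉₊ := by rw [card_product, card_range]

/-- **Brun–Titchmarsh for the values of `x³ + 2y³` on a class of pairs**: there are absolute `C, L₀`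
such that for every box `(A, A+L] × (A', A'+L]`, every `d ≥ 1` and every admissible class
`(a, b) (mod d)` (`gcd(a³ + 2b³, d) = 1`) with `L/d ≥ L₀`,
`#{(x, y) : A < x ≤ A+L, A' < y ≤ A'+L, x ≡ a, y ≡ b (mod d), x³ + 2y³ prime} ≤ C · 𝔈(d) · (L/d)²/log(L/d)`,
`𝔈(d) = ∏_{p∣d}(p+1)/(p+1−ν_p)` (`coprimeClassWeight`). A prime value `≥ (L/d)^{1/2}` is coprime to
`P((L/d)^{1/2})`; the pairs with smaller value have `x, y < (L/d)^{1/2}` and number `≤ 4 L/d`.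
[cite: HalberstamRichert1974, Thm 3.7 (Brun–Titchmarsh), via Thm 2.2 / Thm 2.5] -/
theorem card_classBoxPairs_prime_le :
    ∃ C L₀ : ℝ, 0 < C ∧ ∀ (A A' L d a b : ℕ), 0 < d → Nat.Coprime (a ^ 3 + 2 * b ^ 3) d →
      L₀ ≤ (L : ℝ) / d →
      (#{xy ∈ classBoxPairs A A' L d a b | (xy.1 ^ 3 + 2 * xy.2 ^ 3).Prime} : ℝ) ≤
        C * coprimeClassWeight d * ((L : ℝ) / d) ^ 2 / Real.log ((L : ℝ) / d) := by
  obtain ⟨C, L₀, hC, hrough⟩ := card_classBoxPairs_rough_le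
  -- also `4 t ≤ t² / log t` eventually
  have hev₁ : ∀ᶠ t : ℝ in atTop, ‖Real.log t ^ (1 : ℝ)‖ ≤ (1 / 4) * ‖t ^ (1 : ℝ)‖ :=
    (isLittleO_log_rpow_rpow_atTop 1 one_pos).bound (by norm_num)
  have hev₂ : ∀ᶠ t : ℝ in atTop, max L₀ (Real.exp 1) ≤ t := eventually_ge_atTop _
  obtain ⟨L₁, hL₁⟩ := Filter.eventually_atTop.mp (hev₁.and hev₂)
  refine ⟨C + 1, L₁, by positivity, fun A A' L d a b hd hab hLd => ?_⟩
  obtain ⟨ht1, ht2⟩ := hL₁ ((L : ℝ) / d) hLd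
  have hL₀t : L₀ ≤ (L : ℝ) / d := le_trans (le_max_left _ _) ht2
  have het : Real.exp 1 ≤ (L : ℝ) / d := le_trans (le_max_right _ _) ht2
  have ht_one : 1 ≤ (L : ℝ) / d := le_trans (Real.one_le_exp (by norm_num)) het
  have ht0 : 0 < (L : ℝ) / d := by linarith
  have hlogt : 1 ≤ Real.log ((L : ℝ) / d) := by
    rw [← Real.log_exp 1]; exact Real.log_le_log (Real.exp_pos 1) het
  have hlogt0 : 0 < Real.log ((L : ℝ) / d) := by linarith
  have h4t : 4 * ((L : ℝ) / d) ≤ ((L : ℝ) / d) ^ 2 / Real.log ((L : ℝ) / d) := by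
    have h := ht1
    rw [Real.rpow_one, Real.rpow_one, Real.norm_of_nonneg hlogt0.le, Real.norm_of_nonneg ht0.le] at h
    rw [le_div_iff₀ hlogt0]; nlinarith
  have hmain := hrough A A' L d a b hd hab hL₀t
  have hz0 : 0 ≤ Real.sqrt ((L : ℝ) / d) := Real.sqrt_nonneg _
  have hzsq : Real.sqrt ((L : ℝ) / d) ^ 2 = (L : ℝ) / d := Real.sq_sqrt ht0.le
  have hW : 1 ≤ coprimeClassWeight d := one_le_coprimeClassWeight d
  have hsplit := card_filter_prime_le (classBoxPairs A A' L d a b) (Real.sqrt ((L : ℝ) / d))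
  have hsmall := card_filter_value_lt_le (classBoxPairs A A' L d a b) (Real.sqrt ((L : ℝ) / d))
  have hceil : (⌈Real.sqrt ((L : ℝ) / d)⌉₊ : ℝ) ≤ Real.sqrt ((L : ℝ) / d) + 1 :=
    (Nat.ceil_lt_add_one hz0).le
  have hzt : Real.sqrt ((L : ℝ) / d) ≤ (L : ℝ) / d := by nlinarith
  have hSmall_le : ((⌈Real.sqrt ((L : ℝ) / d)⌉₊ * ⌈Real.sqrt ((L : ℝ) / d)⌉₊ : ℕ) : ℝ) ≤
      4 * ((L : ℝ) / d) := by
    push_cast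
    nlinarith
  have hsplitR : (#{xy ∈ classBoxPairs A A' L d a b | (xy.1 ^ 3 + 2 * xy.2 ^ 3).Prime} : ℝ) ≤
      (#{xy ∈ classBoxPairs A A' L d a b |
          (xy.1 ^ 3 + 2 * xy.2 ^ 3).Coprime (primesProdBelow (Real.sqrt ((L : ℝ) / d)))} : ℝ) +
        ((⌈Real.sqrt ((L : ℝ) / d)⌉₊ * ⌈Real.sqrt ((L : ℝ) / d)⌉₊ : ℕ) : ℝ) := by
    exact_mod_cast hsplit.trans (Nat.add_le_add_left hsmall _)
  set t : ℝ := (L : ℝ) / d with ht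
  have hstep1 : (#{xy ∈ classBoxPairs A A' L d a b | (xy.1 ^ 3 + 2 * xy.2 ^ 3).Prime} : ℝ) ≤
      C * coprimeClassWeight d * t ^ 2 / Real.log t + 4 * t :=
    hsplitR.trans (add_le_add hmain hSmall_le)
  have hstep2 : 4 * t ≤ coprimeClassWeight d * t ^ 2 / Real.log t := by
    calc 4 * t ≤ t ^ 2 / Real.log t := h4t
      _ = 1 * (t ^ 2 / Real.log t) := by rw [one_mul]
      _ ≤ coprimeClassWeight d * (t ^ 2 / Real.log t) :=
          mul_le_mul_of_nonneg_right hW (by positivity)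
      _ = coprimeClassWeight d * t ^ 2 / Real.log t := by ring
  have hfin : C * coprimeClassWeight d * t ^ 2 / Real.log t + coprimeClassWeight d * t ^ 2 / Real.log t =
      (C + 1) * coprimeClassWeight d * t ^ 2 / Real.log t := by ring
  rw [← hfin]
  exact hstep1.trans (add_le_add le_rfl hstep2)

/-! ### The class sieve TWO-SIDED (Fundamental Lemma form), and the box split over classes

Appended 2026-08-27 (parity-ideate lit g13, W5): the same class sequence `seqPairBox` sifted with the
tree's two-sided uniform Fundamental Lemma gives the ASYMPTOTIC count of pairs of an admissible class
with `x³ + 2y³` free of prime factors `< z` (lower half included), with the exact sieve product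
`V_d(z) = ∏_{p<z, p∤d}(1 − ω(p)/p²)`; together with the split of a box over the `d²` classes of pairs
and the vanishing of inadmissible classes this is what turns residue-class densities of the sieve
MODEL of the cubic-form weight into the local densities `ν_d(r)/ν_d*` (parity-ideate route
`GoldbachHeathBrownDispersion`, cruxes ModelDispersion / ModelMainTerm). -/

/-- The sieve product of the class sieve: `V_d(z) = ∏_{p<z} (1 − g_d(p)) = ∏_{p<z, p∤d} (1 − ω(p)/p²)`.
[cite: HalberstamRichert1974, Thm 2.5 (the product `W(z)`)] -/
def classSieveProduct (d : ℕ) (z : ℝ) : ℝ :=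
  ∏ p ∈ Nat.primesBelow ⌈z⌉₊, (1 - pairClassDensity d p)

/-- `V_d(z)` is the density product of `seqPairBox` over `P(z)`. [cite: HalberstamRichert1974, Thm 2.5 (the product `W(z)`)] -/
theorem densityProduct_seqPairBox_eq (A A' L d a b : ℕ) (z : ℝ) :
    (seqPairBox A A' L d a b).densityProduct (primesProdBelow z) = classSieveProduct d z := by
  rw [SieveSequence.densityProduct, primeFactors_primesProdBelow, classSieveProduct]
  rfl

/-- `V_d(z)` with its factors spelled out: `1` at `p ∣ d`, `1 − ω(p)/p²` at `p ∤ d`.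
[cite: HeathBrownMoroz2004, Lemma 2.4] -/
theorem classSieveProduct_eq (d : ℕ) (z : ℝ) :
    classSieveProduct d z =
      ∏ p ∈ Nat.primesBelow ⌈z⌉₊, (if p ∣ d then (1 : ℝ) else 1 - (pairZeroCount p : ℝ) / (p : ℝ) ^ 2) := by
  refine prod_congr rfl fun p hp => ?_
  rw [pairClassDensity_prime d (Nat.prime_of_mem_primesBelow hp)]
  split_ifs <;> simp

/-- `0 < V_d(z)` (every factor is `≥ 1/2`). [cite: HalberstamRichert1974, Thm 2.5 (the product `W(z)`)] -/
theorem classSieveProduct_pos (d : ℕ) (z : ℝ) : 0 < classSieveProduct d z :=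
  prod_pos fun p hp => by
    linarith [(pairClassDensity_prime_bounds d (Nat.prime_of_mem_primesBelow hp)).2.2]

/-- `V_d(z) ≤ 1`. [cite: HalberstamRichert1974, Thm 2.5 (the product `W(z)`)] -/
theorem classSieveProduct_le_one (d : ℕ) (z : ℝ) : classSieveProduct d z ≤ 1 :=
  prod_le_one (fun p hp => by linarith [(pairClassDensity_prime_bounds d (Nat.prime_of_mem_primesBelow hp)).2.2])
    fun p hp => by linarith [(pairClassDensity_prime_bounds d (Nat.prime_of_mem_primesBelow hp)).1]

/-- **The class sieve, two-sided Fundamental Lemma form** (absolute constant, uniform in the modulus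
`d ≥ 1`, the admissible class `(a, b)` and the box): for `2 ≤ z ≤ D`, `2 ≤ D`,
`|#{(x,y) ∈ classBoxPairs : (x³+2y³, P(z)) = 1} − (L/d)² V_d(z)| ≤ C((L/d)² V_d(z) e^{−log D/log z} + (L/d + D) D (log D)⁸)`.
[cite: HalberstamRichert1974, Thm 2.5 (Fundamental Lemma) with Thm 2.2] -/
theorem abs_card_classBoxPairs_rough_sub_le :
    ∃ C : ℝ, 0 < C ∧ ∀ (A A' L d a b : ℕ) (z D : ℝ), 0 < d → Nat.Coprime (a ^ 3 + 2 * b ^ 3) d →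
      2 ≤ z → z ≤ D → 2 ≤ D →
      |(#{xy ∈ classBoxPairs A A' L d a b | (xy.1 ^ 3 + 2 * xy.2 ^ 3).Coprime (primesProdBelow z)} : ℝ) -
          ((L : ℝ) / d) ^ 2 * classSieveProduct d z| ≤
        C * (((L : ℝ) / d) ^ 2 * classSieveProduct d z * Real.exp (-(Real.log D / Real.log z)) +
          ((L : ℝ) / d + D) * D * Real.log D ^ 8) := by
  obtain ⟨C₁, hC₁, hFL⟩ := SieveSequence.fundamental_lemma_uniform_holds 3 dimConst
  obtain ⟨C₂, hC₂, hR⟩ := exists_sum_abs_remainder_seqPairBox_le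
  refine ⟨max C₁ C₂, lt_max_of_lt_left hC₁, fun A A' L d a b z D hd hab hz hzD hD => ?_⟩
  set 𝒜 := seqPairBox A A' L d a b with h𝒜
  have hsize : ∀ x, 𝒜.size x = ((L : ℝ) / d) ^ 2 := fun _ => rfl
  have hX : 0 ≤ 𝒜.size (classBoxTop A A' L : ℝ) := by rw [hsize]; positivity
  have h := hFL 𝒜 (hasSieveDimension_pairClassDensity d) (classBoxTop A A' L : ℝ) z D hz hzD hX
  rw [sifted_seqPairBox_eq, hsize, densityProduct_seqPairBox_eq] at h
  have hrem := hR A A' L d a b z D hd hab hD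
  have hV0 : 0 ≤ classSieveProduct d z := (classSieveProduct_pos d z).le
  have hm1 : C₁ ≤ max C₁ C₂ := le_max_left _ _
  have hm2 : C₂ ≤ max C₁ C₂ := le_max_right _ _
  have hD0 : 0 ≤ D := by linarith
  have hP0 : 0 ≤ ((L : ℝ) / d) ^ 2 * classSieveProduct d z * Real.exp (-(Real.log D / Real.log z)) := by
    positivity
  have hQ0 : 0 ≤ ((L : ℝ) / d + D) * D * Real.log D ^ 8 := by
    have : 0 ≤ Real.log D := Real.log_nonneg (by linarith)
    positivity
  calc _ ≤ C₁ * ((L : ℝ) / d) ^ 2 * classSieveProduct d z * Real.exp (-(Real.log D / Real.log z)) +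
        ∑ q ∈ (primesProdBelow z).divisors.filter (fun q : ℕ => (q : ℝ) ≤ D),
          |𝒜.remainder q (classBoxTop A A' L : ℝ)| := h
    _ ≤ C₁ * (((L : ℝ) / d) ^ 2 * classSieveProduct d z * Real.exp (-(Real.log D / Real.log z))) +
        C₂ * (((L : ℝ) / d + D) * D * Real.log D ^ 8) := by
        have e : C₁ * ((L : ℝ) / d) ^ 2 * classSieveProduct d z * Real.exp (-(Real.log D / Real.log z)) =
            C₁ * (((L : ℝ) / d) ^ 2 * classSieveProduct d z * Real.exp (-(Real.log D / Real.log z))) := by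
          ring
        have e2 : C₂ * ((L : ℝ) / d + D) * D * Real.log D ^ 8 =
            C₂ * (((L : ℝ) / d + D) * D * Real.log D ^ 8) := by ring
        rw [e]
        rw [e2] at hrem
        exact add_le_add le_rfl hrem
    _ ≤ max C₁ C₂ * (((L : ℝ) / d) ^ 2 * classSieveProduct d z * Real.exp (-(Real.log D / Real.log z))) +
        max C₁ C₂ * (((L : ℝ) / d + D) * D * Real.log D ^ 8) :=
        add_le_add (mul_le_mul_of_nonneg_right hm1 hP0) (mul_le_mul_of_nonneg_right hm2 hQ0)
    _ = _ := by ring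

/-- **Splitting a count over a box of pairs into the `d²` residue classes of pairs modulo `d`.**
[cite: HeathBrownMoroz2004, §2 (2.3)–(2.4)] -/
theorem card_filter_box_eq_sum_classBoxPairs {d : ℕ} (hd : 0 < d) (A A' L : ℕ) (Q : ℕ × ℕ → Prop)
    [DecidablePred Q] :
    #{xy ∈ Ioc A (A + L) ×ˢ Ioc A' (A' + L) | Q xy} =
      ∑ ab ∈ range d ×ˢ range d, #{xy ∈ classBoxPairs A A' L d ab.1 ab.2 | Q xy} := by
  classical
  have hmaps : Set.MapsTo (fun xy : ℕ × ℕ => (xy.1 % d, xy.2 % d))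
      ({xy ∈ Ioc A (A + L) ×ˢ Ioc A' (A' + L) | Q xy} : Finset (ℕ × ℕ))
      (range d ×ˢ range d : Finset (ℕ × ℕ)) := by
    intro xy _
    rw [mem_coe, mem_product, mem_range, mem_range]
    exact ⟨Nat.mod_lt _ hd, Nat.mod_lt _ hd⟩
  rw [card_eq_sum_card_fiberwise hmaps]
  refine sum_congr rfl fun ab hab => ?_
  obtain ⟨u, w⟩ := ab
  rw [mem_product, mem_range, mem_range] at hab
  congr 1
  ext ⟨x, y⟩
  simp only [mem_filter, mem_product, classBoxPairs, Prod.mk.injEq, Nat.ModEq, Nat.mod_eq_of_lt hab.1,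
    Nat.mod_eq_of_lt hab.2]
  tauto

/-- On the class `(a, b) (mod d)` the value is `≡ a³ + 2b³ (mod d)`. [cite: HeathBrownMoroz2004, §1 (the class `x⃗ ≡ γ⃗ (mod d)`)] -/
theorem value_modEq_of_mem_classBoxPairs {A A' L d a b : ℕ} {xy : ℕ × ℕ}
    (h : xy ∈ classBoxPairs A A' L d a b) : xy.1 ^ 3 + 2 * xy.2 ^ 3 ≡ a ^ 3 + 2 * b ^ 3 [MOD d] := by
  obtain ⟨-, hx, -, hy⟩ := mem_classBoxPairs_iff.mp h
  exact (hx.pow 3).add ((hy.pow 3).mul_left 2)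

/-- **Inadmissible classes carry no values free of small primes**: if `(a³ + 2b³, d) ≠ 1` and every
prime factor of `d` is `< z`, no pair of the class `(a, b) (mod d)` has `(x³ + 2y³, P(z)) = 1`.
[cite: HeathBrownMoroz2004, §1 (the class `x⃗ ≡ γ⃗ (mod d)`)] -/
theorem card_classBoxPairs_rough_eq_zero {A A' L d a b : ℕ} {z : ℝ}
    (hab : ¬ Nat.Coprime (a ^ 3 + 2 * b ^ 3) d) (hdz : ∀ p : ℕ, p.Prime → p ∣ d → (p : ℝ) < z) :
    #{xy ∈ classBoxPairs A A' L d a b | (xy.1 ^ 3 + 2 * xy.2 ^ 3).Coprime (primesProdBelow z)} = 0 := by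
  rw [card_eq_zero, filter_eq_empty_iff]
  intro xy hxy hcop
  obtain ⟨p, hp, hpv, hpd⟩ := Nat.Prime.not_coprime_iff_dvd.mp hab
  have hpval : p ∣ xy.1 ^ 3 + 2 * xy.2 ^ 3 :=
    (((value_modEq_of_mem_classBoxPairs hxy).of_dvd hpd).dvd_iff dvd_rfl).mpr hpv
  have hpP : p ∣ primesProdBelow z := (dvd_primesProdBelow_iff hp z).mpr (hdz p hp hpd)
  have h1 : p ∣ 1 := by
    have h := Nat.dvd_gcd hpval hpP
    rwa [hcop.gcd_eq_one] at h
  exact hp.one_lt.ne' (Nat.dvd_one.mp h1)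

/-- **The rough values of a box in a residue class `r (mod d)`, split over the classes of pairs**:
`#{(x,y) ∈ box : x³+2y³ ≡ r (d), (x³+2y³, P(z)) = 1} = ∑_{(a,b) mod d, a³+2b³ ≡ r} #{(x,y) ∈ classBoxPairs(a,b) : (x³+2y³, P(z)) = 1}`.
[cite: HeathBrownMoroz2004, §2 (2.3)–(2.4)] -/
theorem card_box_modEq_rough_eq_sum {d : ℕ} (hd : 0 < d) (A A' L r : ℕ) (z : ℝ) :
    #{xy ∈ Ioc A (A + L) ×ˢ Ioc A' (A' + L) |
        xy.1 ^ 3 + 2 * xy.2 ^ 3 ≡ r [MOD d] ∧ (xy.1 ^ 3 + 2 * xy.2 ^ 3).Coprime (primesProdBelow z)} =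
      ∑ ab ∈ (range d ×ˢ range d).filter (fun ab : ℕ × ℕ => ab.1 ^ 3 + 2 * ab.2 ^ 3 ≡ r [MOD d]),
        #{xy ∈ classBoxPairs A A' L d ab.1 ab.2 | (xy.1 ^ 3 + 2 * xy.2 ^ 3).Coprime (primesProdBelow z)} := by
  classical
  rw [card_filter_box_eq_sum_classBoxPairs hd, sum_filter]
  refine sum_congr rfl fun ab _ => ?_
  split_ifs with hr
  · congr 1
    refine filter_congr fun xy hxy => ?_
    exact ⟨fun h => h.2, fun h => ⟨(value_modEq_of_mem_classBoxPairs hxy).trans hr, h⟩⟩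
  · rw [card_eq_zero, filter_eq_empty_iff]
    intro xy hxy h
    exact hr ((value_modEq_of_mem_classBoxPairs hxy).symm.trans h.1)

/-- **All rough values of a box, split over the classes of pairs** (the case without a congruence
condition). [cite: HeathBrownMoroz2004, §2 (2.3)–(2.4)] -/
theorem card_box_rough_eq_sum {d : ℕ} (hd : 0 < d) (A A' L : ℕ) (z : ℝ) :
    #{xy ∈ Ioc A (A + L) ×ˢ Ioc A' (A' + L) | (xy.1 ^ 3 + 2 * xy.2 ^ 3).Coprime (primesProdBelow z)} =
      ∑ ab ∈ range d ×ˢ range d,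
        #{xy ∈ classBoxPairs A A' L d ab.1 ab.2 | (xy.1 ^ 3 + 2 * xy.2 ^ 3).Coprime (primesProdBelow z)} :=
  card_filter_box_eq_sum_classBoxPairs hd A A' L _

end Literature.NumberTheory.Sieve.CubicPrimes

end
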